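import Literature.AlgebraicGeometry.Frobenioids.BaseFrobeniusSectionsAutAmple
import Literature.AlgebraicGeometry.Frobenioids.DivisorialDescriptionsIII
import HarnessLib

/-!
# Frobenioids I, Remark 2.9.2 — unconditional discharge

Mochizuki, *The geometry of Frobenioids I*, Kyushu J. Math. **62** (2008), §2, Remark 2.9.2,
kurims p. 55 [cite: MochizukiFrdI2008, Rem. 2.9.2 p.55].  Combines
`autAmpleSuperfluous_of_thm51iii` (`BaseFrobeniusSectionsAutAmple.lean`) with the proof of
Thm. 5.1 (iii) (`thm51iii_frobeniusTrivial_isAutAmple`, `DivisorialDescriptionsIII.lean`,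
abc-iut-found / abc-iut-L1-t10 / abc-iut-L1-t5).  No new definitions.
-/

namespace Literature.AlgebraicGeometry.Frobenioids

namespace PreFrobenioid

open CategoryTheory

universe w v v' u u'

variable {D : Type u} [Category.{v} D] {Φ : Dᵒᵖ ⥤ CommMonCat.{w}}
  {C : Type u'} [Category.{v'} C] (F : C ⥤ ElemFrobenioid Φ)

/-- **Rmk. 2.9.2, proved**: a Frobenioid of Frobenius-normalized, base-trivial and isotropic type is
of `Aut`-ample type [cf. Theorem 5.1 (iii)]. [cite: MochizukiFrdI2008, Rem. 2.9.2 p.55] -/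
theorem AutAmpleSuperfluous_holds : AutAmpleSuperfluous F :=
  autAmpleSuperfluous_of_thm51iii F (thm51iii_frobeniusTrivial_isAutAmple F)

end PreFrobenioid

end Literature.AlgebraicGeometry.Frobenioids
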